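import Mathlib
import Literature.MathematicalPhysics.QuantumFieldTheory.MagnenRivasseauSeneor1993.MRS93HomotheticDeterminantTransfer
import HarnessLib

/-!
# Magnen–Rivasseau–Sénéor, *Construction of YM₄ with an infrared cutoff* (CMP 155, 1993), §VI Lemma VI.2 at the homothetic gauge:
# the LARGE-β input (H3) «the logarithms of explicit polynomials in β such as those of (VI.14) are bounded by a constant times β at
# large β» (p.374 tl.6–8) PROVED for the CROSS-ordered BF at every `0 < ζ ≤ 1` (in particular `ζ = 3/13`), by the determinant transfer
# of file 18 from the Feynman-gauge theorem of file 9

statement-level skeleton of published theorems with citation tags; proofs where landed; nothing here is a claim about the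
Yang–Mills mass gap, about continuum YM₄ on T⁴, or about the Clay problem

**Citation header (reproduction of PUBLISHED work).** J. Magnen, V. Rivasseau, R. Sénéor, *Construction of YM₄ with an infrared
cutoff*, Commun. Math. Phys. **155** (1993) 325–383 [MagnenRivasseauSeneor1993], §VI (VI.14) p.372, p.374 tl.4–8 and Lemma VI.2 (VI.20a/b)
p.374; App. 1 (A.6) p.379, p.383 tl.1–7. Cell pub-balaban-gaps (YM blitz, track G3), seat mrs-lit-2 (gen 5; §3 = v1.2, gen 6); companion record
`run/shared/lean/pub/pub-balaban-gaps/g3/MRS-AS-PRINTED-estimates.md` §3 (n), (o). Imports file 18 `MRS93HomotheticDeterminantTransfer.lean`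
(`DetTransfer.BF12Cross`, `M3`, `M3_eq_onePlusPsiU`, `neg_half_log_det_transfer`) and through it file 9 `MRS93LemmaVI2FeynmanGauge.lean`
(`FeynmanGauge.angAvg`, `feynmanIntegrand`, `feynmanCubic`, `feynmanCubic_ge`, `feynmanIntegrand_le_largeBeta`, `angAvg_le_of_le_Ioo`, `aConst`,
`L0Const`, `det_onePlusPsiU`), file 8 `MRS93LemmaVI2Reduction.lean` (`Stability.LargeBetaLinear`) and the tree's `MRS93OneLoopCounterterms.lean`
(`OneLoop.countertermFirstOrder`, `integral_sin_zero_pi`, `integral_sin_sq_zero_pi`).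

**What the paper prints.** p.374 tl.4–8 [PDF 50]: the warrant of Lemma VI.2 — «it is easy to check» that the bound holds because «κ, t,
cosθ, sinφ … all vary in compact intervals» and «the logarithms of explicit polynomials in β such as those of (VI.14) are bounded by a
constant times β at large β (uniform in κ, t, cosθ, sinφ, ζ and ζ⁻¹ by compactness)»; Lemma VI.2 (VI.20a): «≤ K₂β if β ≥ (K₁)⁻¹»;
p.383 tl.3–7: «In that case we can use the explicit computations above to establish the necessary bounds. In particular this proves that
the determinant of (−Δ_B^{homothetic})(−Δ^{homothetic})⁻¹ is bounded away from 0 up to a constant factor by the bound (A.6).»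

**The dictionary.** Lemma VI.2's variables `(β, κ, t, θ, φ)` ↦ files 10/15/17/18's `(ψ, x, y, n)` on `p² = 1` (p.372 tl.8–17):
`ψ = κ`, `x = √(β/κ)` (`β = κx²`), `y = tx`, `n = (sinθ sinφ, cosθ, sinθ cosφ, 0)` (`n₁ = cosθ`, `n₂ = sinθ cosφ`, `Σn² = 1`,
`sphere_angles`), `w = ζ⁻¹`. Under it `det BF|_{ζ=1} = det((1 − κ) + κP²)⁴ = S(β, κ, t, θ, φ)⁴` with `S` = file 9's `feynmanCubic`
(`det_M3_dict`), so file 9's `feynmanIntegrand` is exactly the ζ = 1 instance. At `κ = 0` MRS's `β = κx²/p²` vanishes; the typed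
interface (`Stability.LargeBetaLinear`, file 8) quantifies `κ ∈ [0,1]` and `β` independently, and there Lean's `√(β/0) = 0` gives
`BF = 1` (`crossDet_kappa_zero`) — a declared junk value at which the LARGE-β bound below still holds, but at which the SMALL-β hypothesis
(H1) of §2 cannot hold: see finding (o) and §3 (v1.2), and files 20/21 for the regularised dictionary `(√(βκ), β)` that repairs it.

**What this file PROVES (kernel; zero `sorry`, zero named facts).**
* `crossDet`, `crossIntegrand`, `crossF`: the homothetic, cross-ordered integrand of (VI.14)/Lemma VI.2 (three brackets: Faddeev–Popov
  `ln|1 − βκA|`, boson `−½ ln det BF_cross`, counterterm `(β/2)[6(1 + (1/ζ−1)/4) − κ(4 + 3(1/ζ−1)/2)](1 + t²)`) and its angular average.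
* `crossIntegrand_le_feynman` (open square, `β > 0`, `0 < κ ≤ 1`, `0 ≤ t ≤ 1`, `0 < ζ ≤ 1`):
  `crossIntegrand ≤ feynmanIntegrand + (9/2)ln(1/ζ) + (3/2)(1/ζ − 1)β` (file 18 `neg_half_log_det_transfer` + the counterterm brackets
  differ by `(3/2)(1/ζ − 1)(1 − κ)β(1 + t²)/2 ≥ 0`).
* **`crossF_le_largeBeta`**: for `β ≥ a = min(1/16, 1/801)`, `κ, t ∈ [0,1]`, `0 < ζ ≤ 1`:
  `⟨crossIntegrand⟩ ≤ (7 + (3/2)(1/ζ − 1))β + L₀ + (9/2)ln(1/ζ) + 2π + 8` (file 9's log-majorant `7β + L₀ − 4ln sinθ − 4ln sinφ`, re-derived).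
* **`largeBetaLinear_cross`**: `Stability.LargeBetaLinear crossF ζ a C′(ζ)` with `C′(ζ) = 7 + (3/2)(1/ζ − 1) + (L₀ + (9/2)ln(1/ζ) + 2π + 8)/a`
  — the input (H3) of the reduction `Stability.lemmaVI2_at_of_inputs` (file 8) DISCHARGED at every `0 < ζ ≤ 1` for the cross form;
  `largeBetaLinear_cross_homothetic` (ζ = 3/13).
* §2 (v1.1): the same from ANY threshold `0 < a ≤ 1/4` (`crossF_le_largeBeta_from`, `largeBetaLinear_cross_from`, slope `CLargeFrom ζ a`), (H2)
  from (H3) (`middleRangeBound_cross_from`), and **`lemmaVI2_cross_of_smallBeta`**: Lemma VI.2 (VI.20a/b) at any `0 < ζ ≤ 1` for the cross form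
  follows from the small-β input (H1) `Stability.SmallBetaExpansion crossF ζ β₀ C` ALONE (`0 < β₀ ≤ 1/4`, `C ≥ 0`) by file 8's reduction —
  `lemmaVI2_cross_homothetic_of_smallBeta` (ζ = 3/13) — both VACUOUS, see §3.
* §3 (v1.2, finding (o) in the kernel): `crossF_kappa_zero` (`crossF β 0 t ζ = (β/2)·6(1 + (1/ζ − 1)/4)·(1 + t²)`, the junk dictionary value)
  and **`not_smallBetaExpansion_crossF`**: `¬ Stability.SmallBetaExpansion crossF ζ β₀ C` for every `ζ > 0`, `β₀ > 0`, `C` — so the hypothesis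
  `h1` of §2's two conditional theorems is never inhabited. The non-vacuous Lemma VI.2 at the homothetic gauge for the cross form is file 21
  `MRS93HomotheticLemmaVI2` (`CrossLemmaVI2.lemmaVI2_crossReg` for `0 < ζ ≤ 1`, `lemmaVI2_cross_homothetic` at ζ = 3/13, on the regularised
  dictionary of file 20; `lemmaVI2_cross_pos` for THIS file's `crossF` on `κ > 0`, where `crossFReg = crossF`).

**What is NOT claimed.** (H1) and Lemma VI.2 (VI.20b) for this file's `crossF` INCLUDING `κ = 0` (false resp. vacuous there, §3; the repaired
statements live in files 20/21); Lemma VI.1 / (VI.35) at `ζ = 3/13`; anything for the literal ordering of (VI.9) (for which `det BF < 0` at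
large β, file 17, so «ln(1 + βP)» is not even defined there); which ordering the authors intend; nothing about the expansion, the infrared
cutoff (fixed, never lifted), T⁴, or Bałaban's papers.
-/

noncomputable section

open scoped ComplexOrder MatrixOrder
open Complex Matrix Finset

namespace Literature.MathematicalPhysics.QuantumFieldTheory.MagnenRivasseauSeneor1993

namespace CrossLargeBeta

open FeynmanGauge BosonTrace HomotheticA27 DetTransfer MeasureTheory Set intervalIntegral
open scoped Real

/-- The dictionary of p.372 tl.8–17 at `p² = 1`: `x² = β/κ` (`β = κx²/p²`), so `x = √(β/κ)` (for `κ > 0`; at `κ = 0` MRS's `β = κx²/p²`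
vanishes and Lean's `√(β/0) = 0` returns the trivial matrix `BF = 1`). [cite: MagnenRivasseauSeneor1993, §VI p.372 tl.8–17] -/
def xOf (β κ : ℝ) : ℝ := Real.sqrt (β / κ)

/-- `det BF_cross` as a function of Lemma VI.2's variables `(β, κ, t, θ, φ)` (unit momentum `n = (sinθ sinφ, cosθ, sinθ cosφ, 0)`,
`ψ = κ`, `x = √(β/κ)`, `y = tx`, `w = ζ⁻¹`) — the homothetic «1 + βP(β, κ, t, cos θ, sin φ, ζ, 1/ζ)» of (VI.14) for the cross ordering.
[cite: MagnenRivasseauSeneor1993, §VI (VI.14) p.372] -/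
def crossDet (ζ β κ t θ φ : ℝ) : ℝ :=
  ((BF12Cross ζ ζ⁻¹ κ (xOf β κ) (t * xOf β κ) (Real.sin θ * Real.sin φ) (Real.cos θ) (Real.sin θ * Real.cos φ) 0).det).re

/-- **The integrand of Lemma VI.2 at the homothetic gauge, cross ordering**: `ln|1 − βκ[cos²θ + t²sin²θcos²φ]| − ½ ln det BF_cross
+ (β/2)[6(1 + (1/ζ − 1)/4) − κ(4 + 3(1/ζ − 1)/2)](1 + t²)` (the three brackets of (VI.20a/b); counterterm bracket = `OneLoop.countertermFirstOrder`).
[cite: MagnenRivasseauSeneor1993, §VI (VI.14) p.372, Lemma VI.2 (VI.20a/b) p.374] -/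
def crossIntegrand (ζ β κ t θ φ : ℝ) : ℝ :=
  Real.log |1 - β * κ * (Real.cos θ ^ 2 + t ^ 2 * Real.sin θ ^ 2 * Real.cos φ ^ 2)| -
    (1 / 2) * Real.log (crossDet ζ β κ t θ φ) + (β / 2) * OneLoop.countertermFirstOrder ζ κ * (1 + t ^ 2)

/-- Its angular average `(2/π)∫sin²θ dθ ½∫sinφ dφ` — the left side of Lemma VI.2 at gauge parameter `ζ` (cross ordering), in the interface
`F β κ t ζ` of `Stability.LargeBetaLinear`. [cite: MagnenRivasseauSeneor1993, §VI Lemma VI.2 (VI.20a/b) p.374] -/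
def crossF (β κ t ζ : ℝ) : ℝ := angAvg (crossIntegrand ζ β κ t)

/-- The dictionary momentum `n = (sinθ sinφ, cosθ, sinθ cosφ, 0)` lies on the unit sphere (p.372 tl.8–9: `p₁² = p²cos²θ`, `p₂² = p²sin²θcos²φ`).
[cite: MagnenRivasseauSeneor1993, §VI p.372 tl.8–9] -/
theorem sphere_angles (θ φ : ℝ) :
    (Real.sin θ * Real.sin φ) ^ 2 + Real.cos θ ^ 2 + (Real.sin θ * Real.cos φ) ^ 2 + (0 : ℝ) ^ 2 = 1 := by
  nlinarith [Real.sin_sq_add_cos_sq θ, Real.sin_sq_add_cos_sq φ]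

/-- **The Feynman-gauge block under the dictionary is the (VI.15)/(A.6) cubic**: `det((1 − κ) + κP²) = S(β, κ, t, θ, φ)` for `κ > 0`, `β ≥ 0`.
[cite: MagnenRivasseauSeneor1993, §VI (VI.15) p.372; App. 1 (A.6) p.379] -/
theorem det_M3_dict {β κ : ℝ} (hβ : 0 ≤ β) (hκ : 0 < κ) (t θ φ : ℝ) :
    (M3 κ (xOf β κ) (t * xOf β κ) (Real.sin θ * Real.sin φ) (Real.cos θ) (Real.sin θ * Real.cos φ) 0).det =
      ((feynmanCubic β κ t θ φ : ℝ) : ℂ) := by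
  rw [M3_eq_onePlusPsiU _ _ κ (sphere_angles θ φ), det_onePlusPsiU]
  congr 1
  have hX2 : xOf β κ ^ 2 = β / κ := Real.sq_sqrt (div_nonneg hβ hκ.le)
  unfold feynmanCubic
  simp only [mul_pow, hX2]
  field_simp
  ring

/-- At `κ = 0` the dictionary degenerates and `BF_cross = 1`. [cite: MagnenRivasseauSeneor1993, §VI (VI.9) p.370] -/
theorem crossDet_kappa_zero (ζ β t θ φ : ℝ) : crossDet ζ β 0 t θ φ = 1 := by
  have h1 : BF12Cross ζ ζ⁻¹ 0 (xOf β 0) (t * xOf β 0) (Real.sin θ * Real.sin φ) (Real.cos θ) (Real.sin θ * Real.cos φ) 0 = 1 := by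
    ext i j
    rw [BF12Cross_apply, Matrix.one_apply]
    simp [BFm1Cross]
  simp [crossDet, h1]

/-- **Pointwise transfer on the open square** (`θ, φ ∈ (0, π)`, `β ≥ a > 0`, `0 < κ ≤ 1`, `0 ≤ t ≤ 1`, `0 < ζ ≤ 1`): the homothetic
cross-form integrand is at most the Feynman-gauge integrand (file 9) plus `(9/2)ln(1/ζ) + (3/2)(1/ζ − 1)β`.
[cite: MagnenRivasseauSeneor1993, §VI Lemma VI.2 (VI.20a) p.374; App. 1 p.383 tl.3–7] -/
theorem crossIntegrand_le_feynman {ζ β κ t : ℝ} (hζ0 : 0 < ζ) (hζ1 : ζ ≤ 1) (hβ : 0 < β) (hκ0 : 0 < κ) (hκ1 : κ ≤ 1)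
    (ht0 : 0 ≤ t) (ht1 : t ≤ 1) {θ φ : ℝ} (hθ : θ ∈ Ioo (0 : ℝ) π) (hφ : φ ∈ Ioo (0 : ℝ) π) :
    crossIntegrand ζ β κ t θ φ ≤ feynmanIntegrand β κ t θ φ + (9 / 2) * Real.log (1 / ζ) + (3 / 2) * (1 / ζ - 1) * β := by
  have hsθ : 0 < Real.sin θ := Real.sin_pos_of_pos_of_lt_pi hθ.1 hθ.2
  have hsφ : 0 < Real.sin φ := Real.sin_pos_of_pos_of_lt_pi hφ.1 hφ.2
  have hS : 0 < feynmanCubic β κ t θ φ :=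
    lt_of_lt_of_le (by positivity) (feynmanCubic_ge β κ t θ φ hβ.le hκ1 ht0 ht1)
  -- the determinant transfer in these variables
  have hsph := sphere_angles θ φ
  have hw : ζ * ζ⁻¹ = 1 := mul_inv_cancel₀ hζ0.ne'
  have hdet := det_M3_dict (t := t) (θ := θ) (φ := φ) hβ.le hκ0
  have hpos : 0 < ((M3 κ (xOf β κ) (t * xOf β κ) (Real.sin θ * Real.sin φ) (Real.cos θ) (Real.sin θ * Real.cos φ) 0).det ^ 4).re := by
    rw [hdet, ← Complex.ofReal_pow, Complex.ofReal_re]; positivity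
  have htr := neg_half_log_det_transfer (x := xOf β κ) (y := t * xOf β κ) hζ0 hζ1 hw hκ0.le hκ1 hsph hpos
  rw [hdet, ← Complex.ofReal_pow, Complex.ofReal_re] at htr
  -- the counterterm brackets differ by (3/2)(1/ζ − 1)(1 − κ) ∈ [0, (3/2)(1/ζ − 1)]
  have hbr : (β / 2) * OneLoop.countertermFirstOrder ζ κ * (1 + t ^ 2) ≤
      (β / 2) * (6 - 4 * κ) * (1 + t ^ 2) + (3 / 2) * (1 / ζ - 1) * β := by
    have hwz : 0 ≤ 1 / ζ - 1 := by rw [sub_nonneg, le_div_iff₀ hζ0]; linarith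
    have ht2 : t ^ 2 ≤ 1 := by nlinarith
    unfold OneLoop.countertermFirstOrder
    nlinarith [mul_nonneg hwz hκ0.le, mul_nonneg hβ.le hwz, mul_nonneg (mul_nonneg hβ.le hwz) (sq_nonneg t),
      mul_nonneg (mul_nonneg hβ.le hwz) hκ0.le, mul_nonneg (mul_nonneg (mul_nonneg hβ.le hwz) hκ0.le) (sq_nonneg t)]
  unfold crossIntegrand crossDet feynmanIntegrand onePlusBetaP_feynmanDet
  linarith

/-- `x ln x ≥ −1` for `x ≥ 0`. [folklore] -/
private theorem mul_log_ge_neg_one {x : ℝ} (hx0 : 0 ≤ x) : -1 ≤ x * Real.log x := by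
  rcases hx0.eq_or_lt with h | h
  · rw [← h]; simp
  · have hlog := Real.one_sub_inv_le_log_of_pos h
    have hx : x * (1 - x⁻¹) = x - 1 := by field_simp
    have := mul_le_mul_of_nonneg_left hlog h.le
    rw [hx] at this
    linarith

/-- `∫₀^π sinφ (c − 4 ln sinφ) dφ = 2c − 4∫₀^π sinφ ln sinφ dφ` (as in file 9). [folklore] -/
private theorem integral_sin_mul_const_sub_log (c : ℝ) :
    ∫ φ in (0 : ℝ)..π, Real.sin φ * (c - 4 * Real.log (Real.sin φ)) =
      2 * c - 4 * ∫ φ in (0 : ℝ)..π, Real.sin φ * Real.log (Real.sin φ) := by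
  have hsplit : (fun φ => Real.sin φ * (c - 4 * Real.log (Real.sin φ))) =
      fun φ => c * Real.sin φ - 4 * (Real.sin φ * Real.log (Real.sin φ)) := by
    funext φ; ring
  have i1 : IntervalIntegrable (fun φ => c * Real.sin φ) volume 0 π :=
    (by fun_prop : Continuous fun φ => c * Real.sin φ).intervalIntegrable _ _
  have i2 : IntervalIntegrable (fun φ => 4 * (Real.sin φ * Real.log (Real.sin φ))) volume 0 π :=
    (continuous_const.mul (Real.continuous_mul_log.comp Real.continuous_sin)).intervalIntegrable _ _
  rw [hsplit, integral_sub i1 i2, intervalIntegral.integral_const_mul, intervalIntegral.integral_const_mul,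
    OneLoop.integral_sin_zero_pi]
  ring

/-- `−π ≤ ∫₀^π sinφ ln sinφ dφ` and `−π ≤ ∫₀^π sin²θ ln sinθ dθ` (as in file 9). [folklore] -/
private theorem integral_sin_mul_log_sin_ge :
    -π ≤ ∫ φ in (0 : ℝ)..π, Real.sin φ * Real.log (Real.sin φ) ∧
      -π ≤ ∫ θ in (0 : ℝ)..π, Real.sin θ ^ 2 * Real.log (Real.sin θ) := by
  have hπ : (0 : ℝ) ≤ π := Real.pi_pos.le
  have hc1 : Continuous fun φ => Real.sin φ * Real.log (Real.sin φ) :=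
    Real.continuous_mul_log.comp Real.continuous_sin
  have hc2 : Continuous fun θ => Real.sin θ ^ 2 * Real.log (Real.sin θ) := by
    have : (fun θ => Real.sin θ ^ 2 * Real.log (Real.sin θ)) =
        fun θ => Real.sin θ * (Real.sin θ * Real.log (Real.sin θ)) := by funext θ; ring
    rw [this]
    exact Real.continuous_sin.mul hc1
  have hconst : ∫ _ in (0 : ℝ)..π, (-1 : ℝ) = -π := by simp
  constructor
  · rw [← hconst]
    apply integral_mono_on hπ (by simp) (hc1.intervalIntegrable _ _)
    intro φ hφ
    exact mul_log_ge_neg_one (Real.sin_nonneg_of_nonneg_of_le_pi hφ.1 hφ.2)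
  · rw [← hconst]
    apply integral_mono_on hπ (by simp) (hc2.intervalIntegrable _ _)
    intro θ hθ
    have hs0 := Real.sin_nonneg_of_nonneg_of_le_pi hθ.1 hθ.2
    have hs1 := Real.sin_le_one θ
    have h := mul_log_ge_neg_one hs0
    have key := mul_nonneg hs0 (show 0 ≤ Real.sin θ * Real.log (Real.sin θ) + 1 by linarith)
    have : Real.sin θ ^ 2 * Real.log (Real.sin θ) =
        Real.sin θ * (Real.sin θ * Real.log (Real.sin θ) + 1) - Real.sin θ := by ring
    rw [this]
    linarith

/-- `⟨c − 4 ln sinθ − 4 ln sinφ⟩ ≤ c + 2π + 8` (as in file 9). [folklore] -/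
private theorem angAvg_logMajorant_le (c : ℝ) :
    angAvg (fun θ φ => c - 4 * Real.log (Real.sin θ) - 4 * Real.log (Real.sin φ)) ≤ c + 2 * π + 8 := by
  unfold angAvg
  obtain ⟨hJ₀ge, hJ₂ge⟩ := integral_sin_mul_log_sin_ge
  set J₀ := ∫ φ in (0 : ℝ)..π, Real.sin φ * Real.log (Real.sin φ) with hJ₀
  set J₂ := ∫ θ in (0 : ℝ)..π, Real.sin θ ^ 2 * Real.log (Real.sin θ) with hJ₂
  have hinner : ∀ θ : ℝ, (∫ φ in (0 : ℝ)..π, Real.sin φ * (c - 4 * Real.log (Real.sin θ) - 4 * Real.log (Real.sin φ))) =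
      2 * (c - 4 * Real.log (Real.sin θ)) - 4 * J₀ := fun θ => integral_sin_mul_const_sub_log _
  simp_rw [hinner]
  have hsplit : (fun θ => Real.sin θ ^ 2 * (1 / 2 * (2 * (c - 4 * Real.log (Real.sin θ)) - 4 * J₀))) =
      fun θ => (c - 2 * J₀) * Real.sin θ ^ 2 - 4 * (Real.sin θ ^ 2 * Real.log (Real.sin θ)) := by
    funext θ; ring
  have hc2 : Continuous fun θ => Real.sin θ ^ 2 * Real.log (Real.sin θ) := by
    have : (fun θ => Real.sin θ ^ 2 * Real.log (Real.sin θ)) =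
        fun θ => Real.sin θ * (Real.sin θ * Real.log (Real.sin θ)) := by funext θ; ring
    rw [this]
    exact Real.continuous_sin.mul (Real.continuous_mul_log.comp Real.continuous_sin)
  have i1 : IntervalIntegrable (fun θ => (c - 2 * J₀) * Real.sin θ ^ 2) volume 0 π :=
    (by fun_prop : Continuous fun θ => (c - 2 * J₀) * Real.sin θ ^ 2).intervalIntegrable _ _
  have i2 : IntervalIntegrable (fun θ => 4 * (Real.sin θ ^ 2 * Real.log (Real.sin θ))) volume 0 π :=
    (continuous_const.mul hc2).intervalIntegrable _ _
  rw [hsplit, integral_sub i1 i2, intervalIntegral.integral_const_mul, intervalIntegral.integral_const_mul,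
    OneLoop.integral_sin_sq_zero_pi]
  have hπ0 : 0 < π := Real.pi_pos
  have hJ₂' : (∫ θ in (0 : ℝ)..π, Real.sin θ ^ 2 * Real.log (Real.sin θ)) = J₂ := rfl
  rw [hJ₂']
  rw [show 2 / π * ((c - 2 * J₀) * (π / 2) - 4 * J₂) = c - 2 * J₀ - 8 / π * J₂ by field_simp; ring]
  have h8 : -(8 / π * J₂) ≤ 8 := by
    have : 8 / π * (-J₂) ≤ 8 / π * π := mul_le_mul_of_nonneg_left (by linarith) (by positivity)
    have h' : 8 / π * π = 8 := by field_simp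
    linarith
  linarith

/-- `a = min(1/16, 1/801) > 0` (file 9's `aConst`; its positivity lemma there is private). [cite: MagnenRivasseauSeneor1993, §VI Lemma VI.2 (VI.20a) p.374] -/
theorem aConst_pos' : 0 < aConst := lt_min (by norm_num) (by norm_num)

/-- `L₀ = −2 ln(4a) ≥ 0` (file 9's `L0Const`). [cite: MagnenRivasseauSeneor1993, §VI Lemma VI.2 (VI.20a) p.374] -/
theorem L0Const_nonneg' : 0 ≤ L0Const := by
  unfold L0Const
  have h4a1 : 4 * aConst ≤ 1 := by
    have : aConst ≤ 1 / 16 := min_le_left _ _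
    linarith
  have := Real.log_nonpos (by linarith [aConst_pos']) h4a1
  linarith

/-- The constant term of the large-β majorant for the cross form: `L₀ + (9/2)ln(1/ζ)`. [cite: MagnenRivasseauSeneor1993, §VI Lemma VI.2 (VI.20a) p.374] -/
def L0Cross (ζ : ℝ) : ℝ := L0Const + (9 / 2) * Real.log (1 / ζ)

/-- The slope of (H3) for the cross form: `C′(ζ) = 7 + (3/2)(1/ζ − 1) + (L₀ + (9/2)ln(1/ζ) + 2π + 8)/a`.
[cite: MagnenRivasseauSeneor1993, §VI Lemma VI.2 (VI.20a) p.374] -/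
def CLargeCross (ζ : ℝ) : ℝ := 7 + (3 / 2) * (1 / ζ - 1) + (L0Cross ζ + 2 * π + 8) / aConst

/-- **(H3)-type bound for the homothetic cross form, all `β ≥ a`**: `F_ζ(β, κ, t) ≤ (7 + (3/2)(1/ζ − 1))β + L₀ + (9/2)ln(1/ζ) + 2π + 8`
(`0 < ζ ≤ 1`, `0 ≤ κ ≤ 1`, `0 ≤ t ≤ 1`). [cite: MagnenRivasseauSeneor1993, §VI p.374 tl.6–8, Lemma VI.2 (VI.20a) p.374; App. 1 p.383 tl.3–7] -/
theorem crossF_le_largeBeta {ζ β κ t : ℝ} (hζ0 : 0 < ζ) (hζ1 : ζ ≤ 1) (haβ : aConst ≤ β) (hκ0 : 0 ≤ κ) (hκ1 : κ ≤ 1)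
    (ht0 : 0 ≤ t) (ht1 : t ≤ 1) :
    crossF β κ t ζ ≤ (7 + (3 / 2) * (1 / ζ - 1)) * β + L0Cross ζ + 2 * π + 8 := by
  have hβ : 0 < β := aConst_pos'.trans_le haβ
  have hwz : 0 ≤ 1 / ζ - 1 := by rw [sub_nonneg, le_div_iff₀ hζ0]; linarith
  have hlz : 0 ≤ Real.log (1 / ζ) := Real.log_nonneg (by rw [le_div_iff₀ hζ0]; linarith)
  unfold crossF
  rcases hκ0.eq_or_lt with hκ | hκ
  · -- κ = 0: the integrand is the constant (β/2)·6(1 + (1/ζ − 1)/4)·(1 + t²)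
    subst hκ
    have hconst : crossIntegrand ζ β 0 t = fun _ _ => (β / 2) * OneLoop.countertermFirstOrder ζ 0 * (1 + t ^ 2) := by
      funext θ φ
      simp [crossIntegrand, crossDet_kappa_zero]
    rw [hconst, angAvg_const]
    unfold OneLoop.countertermFirstOrder L0Cross
    have ht2 : t ^ 2 ≤ 1 := by nlinarith
    nlinarith [mul_nonneg hβ.le hwz, mul_nonneg (mul_nonneg hβ.le hwz) (sq_nonneg t), Real.pi_pos, L0Const_nonneg',
      mul_nonneg hβ.le (sq_nonneg t)]
  · have hlogsin : ∀ x : ℝ, Real.log (Real.sin x) ≤ 0 := fun x => by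
      rw [← Real.log_abs]
      exact Real.log_nonpos (abs_nonneg _) (Real.abs_sin_le_one x)
    set c := (7 + (3 / 2) * (1 / ζ - 1)) * β + L0Cross ζ with hc
    have hL0 : 0 ≤ L0Cross ζ := by
      unfold L0Cross; nlinarith [L0Const_nonneg', hlz]
    have hc0 : 0 ≤ c := by
      rw [hc]; nlinarith [mul_nonneg hβ.le hwz, hL0, hβ.le]
    have hmono : angAvg (crossIntegrand ζ β κ t) ≤
        angAvg (fun θ φ => c - 4 * Real.log (Real.sin θ) - 4 * Real.log (Real.sin φ)) := by
      apply angAvg_le_of_le_Ioo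
      · intro θ _
        have : (fun φ => Real.sin φ * (c - 4 * Real.log (Real.sin θ) - 4 * Real.log (Real.sin φ))) =
            fun φ => (c - 4 * Real.log (Real.sin θ)) * Real.sin φ - 4 * (Real.sin φ * Real.log (Real.sin φ)) := by
          funext φ; ring
        rw [this]
        exact ((continuous_const.mul Real.continuous_sin).sub
          (continuous_const.mul (Real.continuous_mul_log.comp Real.continuous_sin))).intervalIntegrable _ _
      · have hJ : ∀ θ : ℝ, (∫ φ in (0 : ℝ)..π, Real.sin φ *
            (c - 4 * Real.log (Real.sin θ) - 4 * Real.log (Real.sin φ))) =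
            2 * (c - 4 * Real.log (Real.sin θ)) - 4 * ∫ φ in (0 : ℝ)..π, Real.sin φ * Real.log (Real.sin φ) :=
          fun θ => integral_sin_mul_const_sub_log _
        simp_rw [hJ]
        have : (fun θ => Real.sin θ ^ 2 * (1 / 2 * (2 * (c - 4 * Real.log (Real.sin θ)) -
            4 * ∫ φ in (0 : ℝ)..π, Real.sin φ * Real.log (Real.sin φ)))) =
            fun θ => (c - 2 * ∫ φ in (0 : ℝ)..π, Real.sin φ * Real.log (Real.sin φ)) *
              Real.sin θ ^ 2 - 4 * (Real.sin θ * (Real.sin θ * Real.log (Real.sin θ))) := by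
          funext θ; ring
        rw [this]
        exact ((continuous_const.mul (Real.continuous_sin.pow 2)).sub (continuous_const.mul
          (Real.continuous_sin.mul (Real.continuous_mul_log.comp Real.continuous_sin)))).intervalIntegrable _ _
      · intro θ hθ φ hφ
        have h1 := crossIntegrand_le_feynman hζ0 hζ1 hβ hκ hκ1 ht0 ht1 hθ hφ
        have h2 := feynmanIntegrand_le_largeBeta aConst_pos' haβ hκ0 hκ1 ht0 ht1 hθ hφ
        rw [hc]
        unfold L0Cross L0Const
        linarith
      · intro θ φ
        linarith [hlogsin θ, hlogsin φ, hc0]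
    have hbound := angAvg_logMajorant_le c
    linarith

/-- **(H3) `LargeBetaLinear` for the homothetic cross form** (`0 < ζ ≤ 1`): `F_ζ ≤ C′(ζ)·β` for `β ≥ a`, `κ, t ∈ [0, 1]` — the large-β
input of the reduction `Stability.lemmaVI2_at_of_inputs` (file 8), now discharged at the homothetic gauge for the cross-ordered BF via the
determinant transfer; the small-β input (H1) and hence Lemma VI.2 itself at `ζ = 3/13` are NOT proved here.
[cite: MagnenRivasseauSeneor1993, §VI p.374 tl.6–8, Lemma VI.2 (VI.20a) p.374; App. 1 p.383 tl.1–7] -/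
theorem largeBetaLinear_cross {ζ : ℝ} (hζ0 : 0 < ζ) (hζ1 : ζ ≤ 1) :
    Stability.LargeBetaLinear crossF ζ aConst (CLargeCross ζ) := by
  intro β κ t haβ hκ0 hκ1 ht0 ht1
  have h := crossF_le_largeBeta hζ0 hζ1 haβ hκ0 hκ1 ht0 ht1
  have ha := aConst_pos'
  have hβa : 1 ≤ β / aConst := by rw [le_div_iff₀ ha]; linarith
  have hlz : 0 ≤ Real.log (1 / ζ) := Real.log_nonneg (by rw [le_div_iff₀ hζ0]; linarith)
  have hK : 0 ≤ L0Cross ζ + 2 * π + 8 := by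
    have : 0 ≤ L0Cross ζ := by unfold L0Cross; linarith [L0Const_nonneg', mul_nonneg (by norm_num : (0:ℝ) ≤ 9 / 2) hlz]
    linarith [Real.pi_pos]
  have hlin : L0Cross ζ + 2 * π + 8 ≤ (L0Cross ζ + 2 * π + 8) / aConst * β := by
    calc L0Cross ζ + 2 * π + 8 = (L0Cross ζ + 2 * π + 8) * 1 := (mul_one _).symm
      _ ≤ (L0Cross ζ + 2 * π + 8) * (β / aConst) := mul_le_mul_of_nonneg_left hβa hK
      _ = (L0Cross ζ + 2 * π + 8) / aConst * β := by field_simp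
  unfold CLargeCross
  linarith

/-- At the homothetic point `ζ = 3/13`: (H3) with `a = min(1/16, 1/801)` and `C′(3/13) = 12 + (L₀ + (9/2)ln(13/3) + 2π + 8)/a`.
[cite: MagnenRivasseauSeneor1993, §VI Lemma VI.2 (VI.20a) p.374; §II p.339 tl.34] -/
theorem largeBetaLinear_cross_homothetic : Stability.LargeBetaLinear crossF (3 / 13) aConst (CLargeCross (3 / 13)) :=
  largeBetaLinear_cross (by norm_num) (by norm_num)


/-! ## §2 (v1.1) Large β from an arbitrary threshold `a ∈ (0, 1/4]`, and Lemma VI.2 at the homothetic gauge MODULO the small-β input (H1) -/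

/-- **(H3)-type bound from any threshold `0 < a ≤ 1/4`**: for `β ≥ a`, `κ, t ∈ [0,1]`, `0 < ζ ≤ 1`,
`F_ζ(β, κ, t) ≤ (7 + (3/2)(1/ζ − 1))β − 2ln(4a) + (9/2)ln(1/ζ) + 2π + 8`. [cite: MagnenRivasseauSeneor1993, §VI p.374 tl.6–8, Lemma VI.2 (VI.20a) p.374] -/
theorem crossF_le_largeBeta_from {ζ a β κ t : ℝ} (hζ0 : 0 < ζ) (hζ1 : ζ ≤ 1) (ha : 0 < a) (ha4 : a ≤ 1 / 4) (haβ : a ≤ β)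
    (hκ0 : 0 ≤ κ) (hκ1 : κ ≤ 1) (ht0 : 0 ≤ t) (ht1 : t ≤ 1) :
    crossF β κ t ζ ≤ (7 + (3 / 2) * (1 / ζ - 1)) * β - 2 * Real.log (4 * a) + (9 / 2) * Real.log (1 / ζ) + 2 * π + 8 := by
  have hβ : 0 < β := ha.trans_le haβ
  have hwz : 0 ≤ 1 / ζ - 1 := by rw [sub_nonneg, le_div_iff₀ hζ0]; linarith
  have hlz : 0 ≤ Real.log (1 / ζ) := Real.log_nonneg (by rw [le_div_iff₀ hζ0]; linarith)
  have hla : 0 ≤ -(2 * Real.log (4 * a)) := by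
    have := Real.log_nonpos (by linarith : 0 ≤ 4 * a) (by linarith : 4 * a ≤ 1)
    linarith
  unfold crossF
  rcases hκ0.eq_or_lt with hκ | hκ
  · subst hκ
    have hconst : crossIntegrand ζ β 0 t = fun _ _ => (β / 2) * OneLoop.countertermFirstOrder ζ 0 * (1 + t ^ 2) := by
      funext θ φ
      simp [crossIntegrand, crossDet_kappa_zero]
    rw [hconst, angAvg_const]
    unfold OneLoop.countertermFirstOrder
    have ht2 : t ^ 2 ≤ 1 := by nlinarith
    nlinarith [mul_nonneg hβ.le hwz, mul_nonneg (mul_nonneg hβ.le hwz) (sq_nonneg t), Real.pi_pos,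
      mul_nonneg hβ.le (sq_nonneg t)]
  · have hlogsin : ∀ x : ℝ, Real.log (Real.sin x) ≤ 0 := fun x => by
      rw [← Real.log_abs]
      exact Real.log_nonpos (abs_nonneg _) (Real.abs_sin_le_one x)
    set c := (7 + (3 / 2) * (1 / ζ - 1)) * β - 2 * Real.log (4 * a) + (9 / 2) * Real.log (1 / ζ) with hc
    have hc0 : 0 ≤ c := by
      rw [hc]; nlinarith [mul_nonneg hβ.le hwz, hβ.le]
    have hmono : angAvg (crossIntegrand ζ β κ t) ≤
        angAvg (fun θ φ => c - 4 * Real.log (Real.sin θ) - 4 * Real.log (Real.sin φ)) := by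
      apply angAvg_le_of_le_Ioo
      · intro θ _
        have : (fun φ => Real.sin φ * (c - 4 * Real.log (Real.sin θ) - 4 * Real.log (Real.sin φ))) =
            fun φ => (c - 4 * Real.log (Real.sin θ)) * Real.sin φ - 4 * (Real.sin φ * Real.log (Real.sin φ)) := by
          funext φ; ring
        rw [this]
        exact ((continuous_const.mul Real.continuous_sin).sub
          (continuous_const.mul (Real.continuous_mul_log.comp Real.continuous_sin))).intervalIntegrable _ _
      · have hJ : ∀ θ : ℝ, (∫ φ in (0 : ℝ)..π, Real.sin φ *
            (c - 4 * Real.log (Real.sin θ) - 4 * Real.log (Real.sin φ))) =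
            2 * (c - 4 * Real.log (Real.sin θ)) - 4 * ∫ φ in (0 : ℝ)..π, Real.sin φ * Real.log (Real.sin φ) :=
          fun θ => integral_sin_mul_const_sub_log _
        simp_rw [hJ]
        have : (fun θ => Real.sin θ ^ 2 * (1 / 2 * (2 * (c - 4 * Real.log (Real.sin θ)) -
            4 * ∫ φ in (0 : ℝ)..π, Real.sin φ * Real.log (Real.sin φ)))) =
            fun θ => (c - 2 * ∫ φ in (0 : ℝ)..π, Real.sin φ * Real.log (Real.sin φ)) *
              Real.sin θ ^ 2 - 4 * (Real.sin θ * (Real.sin θ * Real.log (Real.sin θ))) := by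
          funext θ; ring
        rw [this]
        exact ((continuous_const.mul (Real.continuous_sin.pow 2)).sub (continuous_const.mul
          (Real.continuous_sin.mul (Real.continuous_mul_log.comp Real.continuous_sin)))).intervalIntegrable _ _
      · intro θ hθ φ hφ
        have h1 := crossIntegrand_le_feynman hζ0 hζ1 hβ hκ hκ1 ht0 ht1 hθ hφ
        have h2 := feynmanIntegrand_le_largeBeta ha haβ hκ0 hκ1 ht0 ht1 hθ hφ
        rw [hc]
        linarith
      · intro θ φ
        linarith [hlogsin θ, hlogsin φ, hc0]
    have hbound := angAvg_logMajorant_le c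
    linarith

/-- `C′(ζ, a) := 7 + (3/2)(1/ζ − 1) + (−2ln(4a) + (9/2)ln(1/ζ) + 2π + 8)/a`, the slope of (H3) from threshold `a`.
[cite: MagnenRivasseauSeneor1993, §VI Lemma VI.2 (VI.20a) p.374] -/
def CLargeFrom (ζ a : ℝ) : ℝ := 7 + (3 / 2) * (1 / ζ - 1) + (-(2 * Real.log (4 * a)) + (9 / 2) * Real.log (1 / ζ) + 2 * π + 8) / a

/-- (H3) from any threshold `0 < a ≤ 1/4`: `Stability.LargeBetaLinear crossF ζ a C′(ζ, a)`. [cite: MagnenRivasseauSeneor1993, §VI Lemma VI.2 (VI.20a) p.374] -/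
theorem largeBetaLinear_cross_from {ζ a : ℝ} (hζ0 : 0 < ζ) (hζ1 : ζ ≤ 1) (ha : 0 < a) (ha4 : a ≤ 1 / 4) :
    Stability.LargeBetaLinear crossF ζ a (CLargeFrom ζ a) := by
  intro β κ t haβ hκ0 hκ1 ht0 ht1
  have h := crossF_le_largeBeta_from hζ0 hζ1 ha ha4 haβ hκ0 hκ1 ht0 ht1
  have hβa : 1 ≤ β / a := by rw [le_div_iff₀ ha]; linarith
  have hlz : 0 ≤ Real.log (1 / ζ) := Real.log_nonneg (by rw [le_div_iff₀ hζ0]; linarith)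
  have hla : 0 ≤ -(2 * Real.log (4 * a)) := by
    have := Real.log_nonpos (by linarith : 0 ≤ 4 * a) (by linarith : 4 * a ≤ 1)
    linarith
  have hK : 0 ≤ -(2 * Real.log (4 * a)) + (9 / 2) * Real.log (1 / ζ) + 2 * π + 8 := by
    linarith [Real.pi_pos, mul_nonneg (by norm_num : (0:ℝ) ≤ 9 / 2) hlz]
  have hlin : -(2 * Real.log (4 * a)) + (9 / 2) * Real.log (1 / ζ) + 2 * π + 8 ≤
      (-(2 * Real.log (4 * a)) + (9 / 2) * Real.log (1 / ζ) + 2 * π + 8) / a * β := by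
    calc -(2 * Real.log (4 * a)) + (9 / 2) * Real.log (1 / ζ) + 2 * π + 8
        = (-(2 * Real.log (4 * a)) + (9 / 2) * Real.log (1 / ζ) + 2 * π + 8) * 1 := (mul_one _).symm
      _ ≤ (-(2 * Real.log (4 * a)) + (9 / 2) * Real.log (1 / ζ) + 2 * π + 8) * (β / a) := mul_le_mul_of_nonneg_left hβa hK
      _ = (-(2 * Real.log (4 * a)) + (9 / 2) * Real.log (1 / ζ) + 2 * π + 8) / a * β := by field_simp
  unfold CLargeFrom
  linarith

/-- `C′(ζ, a) ≥ 0` for `0 < a ≤ 1/4`, `0 < ζ ≤ 1` (plumbing). [cite: MagnenRivasseauSeneor1993, §VI Lemma VI.2 (VI.20a) p.374] -/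
theorem CLargeFrom_nonneg {ζ a : ℝ} (hζ0 : 0 < ζ) (hζ1 : ζ ≤ 1) (ha : 0 < a) (ha4 : a ≤ 1 / 4) : 0 ≤ CLargeFrom ζ a := by
  unfold CLargeFrom
  have hwz : 0 ≤ 1 / ζ - 1 := by rw [sub_nonneg, le_div_iff₀ hζ0]; linarith
  have hlz : 0 ≤ Real.log (1 / ζ) := Real.log_nonneg (by rw [le_div_iff₀ hζ0]; linarith)
  have hla : 0 ≤ -(2 * Real.log (4 * a)) := by
    have := Real.log_nonpos (by linarith : 0 ≤ 4 * a) (by linarith : 4 * a ≤ 1)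
    linarith
  have : 0 ≤ (-(2 * Real.log (4 * a)) + (9 / 2) * Real.log (1 / ζ) + 2 * π + 8) / a :=
    div_nonneg (by linarith [Real.pi_pos, mul_nonneg (by norm_num : (0:ℝ) ≤ 9 / 2) hlz]) ha.le
  positivity

/-- (H2) from (H3): on any middle range `[a, b]` with `0 < a ≤ 1/4`, `F_ζ ≤ C′(ζ, a)·b`. [cite: MagnenRivasseauSeneor1993, §VI p.374 tl.4–8] -/
theorem middleRangeBound_cross_from {ζ a b : ℝ} (hζ0 : 0 < ζ) (hζ1 : ζ ≤ 1) (ha : 0 < a) (ha4 : a ≤ 1 / 4) :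
    Stability.MiddleRangeBound crossF ζ a b (CLargeFrom ζ a * b) := by
  intro β κ t haβ hβb hκ0 hκ1 ht0 ht1
  have h := largeBetaLinear_cross_from hζ0 hζ1 ha ha4 β κ t haβ hκ0 hκ1 ht0 ht1
  have : CLargeFrom ζ a * β ≤ CLargeFrom ζ a * b := mul_le_mul_of_nonneg_left hβb (CLargeFrom_nonneg hζ0 hζ1 ha ha4)
  linarith

/-- **Lemma VI.2 (VI.20a/b) at the homothetic gauge for the CROSS-ordered BF, MODULO the small-β input (H1).** For `0 < ζ ≤ 1`: if the
uniform small-β expansion `Stability.SmallBetaExpansion crossF ζ β₀ C` holds for some `0 < β₀ ≤ 1/4`, `C ≥ 0` (the paper's (VI.18)–(VI.19)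
with a uniform `O(β²)` — for the cross form its first order is the PROVED (VI.17), file 10, but the remainder is NOT proved here), then
«there exists two constants K₁ and K₂ such that [F_ζ] ≤ K₂β if β ≥ (K₁)⁻¹ (VI.20a); ≤ −(β/8) if β ≤ (K₁)⁻¹ (VI.20b)», by file 8's
reduction with (H3) = `largeBetaLinear_cross_from` and (H2) = `middleRangeBound_cross_from` supplied here. This isolates exactly what is
still open at ζ = 3/13: the small-β remainder. [cite: MagnenRivasseauSeneor1993, §VI Lemma VI.2 (VI.20a)–(VI.20b) p.374, p.374 tl.4–8] -/
theorem lemmaVI2_cross_of_smallBeta {ζ β₀ C : ℝ} (hζ0 : 0 < ζ) (hζ1 : ζ ≤ 1) (hβ₀ : 0 < β₀) (hβ₀4 : β₀ ≤ 1 / 4) (hC : 0 ≤ C)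
    (h1 : Stability.SmallBetaExpansion crossF ζ β₀ C) :
    ∃ K₁ K₂ : ℝ, 0 < K₁ ∧ 0 < K₂ ∧
      ∀ β κ t : ℝ, 0 ≤ β → 0 ≤ κ → κ ≤ 1 → 0 ≤ t → t ≤ 1 →
        (K₁⁻¹ ≤ β → crossF β κ t ζ ≤ K₂ * β) ∧ (β ≤ K₁⁻¹ → crossF β κ t ζ ≤ -(β / 8)) := by
  set a : ℝ := min β₀ (1 / (8 * C + 1)) with ha
  have ha0 : 0 < a := lt_min hβ₀ (by positivity)
  have ha4 : a ≤ 1 / 4 := (min_le_left _ _).trans hβ₀4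
  exact Stability.lemmaVI2_at_of_inputs (F := crossF) hβ₀ hC h1 (largeBetaLinear_cross_from hζ0 hζ1 ha0 ha4)
    (middleRangeBound_cross_from hζ0 hζ1 ha0 ha4)

/-- The homothetic instance `ζ = 3/13`: Lemma VI.2 for the cross form follows from (H1) alone.
[cite: MagnenRivasseauSeneor1993, §VI Lemma VI.2 (VI.20a)–(VI.20b) p.374; §II p.339 tl.34] -/
theorem lemmaVI2_cross_homothetic_of_smallBeta {β₀ C : ℝ} (hβ₀ : 0 < β₀) (hβ₀4 : β₀ ≤ 1 / 4) (hC : 0 ≤ C)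
    (h1 : Stability.SmallBetaExpansion crossF (3 / 13) β₀ C) :
    ∃ K₁ K₂ : ℝ, 0 < K₁ ∧ 0 < K₂ ∧
      ∀ β κ t : ℝ, 0 ≤ β → 0 ≤ κ → κ ≤ 1 → 0 ≤ t → t ≤ 1 →
        (K₁⁻¹ ≤ β → crossF β κ t (3 / 13) ≤ K₂ * β) ∧ (β ≤ K₁⁻¹ → crossF β κ t (3 / 13) ≤ -(β / 8)) :=
  lemmaVI2_cross_of_smallBeta (by norm_num) (by norm_num) hβ₀ hβ₀4 hC h1

/-! ## §3 (v1.2). Finding (o) in the kernel: the hypothesis (H1) of §2 is unsatisfiable for this file's `crossF`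

The dictionary `x = √(β/κ)` of `xOf` returns Lean's junk value `√(β/0) = 0` at `κ = 0` (declared in the header and at `crossDet_kappa_zero`),
so `crossF β 0 t ζ` is the counterterm bracket alone, `(β/2)·6(1 + (1/ζ − 1)/4)·(1 + t²) > 0` for `β > 0`, `ζ > 0`; but (H1)
`Stability.SmallBetaExpansion crossF ζ β₀ C` demands `crossF ≤ −β/4 + Cβ²` for all `0 ≤ β ≤ β₀` INCLUDING `κ = 0`, which fails for small
`β > 0`. Hence `lemmaVI2_cross_of_smallBeta` / `lemmaVI2_cross_homothetic_of_smallBeta` above are correct but VACUOUS (their hypothesis `h1` is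
never inhabited). In MRS's own variables `β = κx²` (p.372 tl.15–17) the point `(β > 0, κ = 0)` does not exist; the repair is the regularised
dictionary `(a, b) = (√(βκ), β)` of file 20 `MRS93HomotheticSmallBeta` (`BFreg`, continuous down to `κ = 0`), on which file 21
`MRS93HomotheticLemmaVI2` PROVES (H1) (`CrossLemmaVI2.smallBetaExpansion_crossReg`) and Lemma VI.2 (VI.20a/b) for the cross form at every
`0 < ζ ≤ 1` (`lemmaVI2_crossReg`), at ζ = 3/13 (`lemmaVI2_cross_homothetic`), and — for THIS file's `crossF` restricted to `κ > 0`, where the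
two dictionaries agree (`crossFReg_eq_crossF`) — `lemmaVI2_cross_pos`. Nothing below is printed mathematics: it certifies a property of the
typed object. -/

/-- At `κ = 0` the typed `crossF` is the counterterm bracket alone: `crossF β 0 t ζ = (β/2)·[6(1 + (1/ζ − 1)/4)]·(1 + t²)` (junk value of the
dictionary `x = √(β/0) = 0`, `BF = 1`, `ln|1 − 0| = 0`). [cite: MagnenRivasseauSeneor1993, §VI (VI.14) p.372 tl.15–17, Lemma VI.2 p.374] -/
theorem crossF_kappa_zero (ζ β t : ℝ) :
    crossF β 0 t ζ = (β / 2) * OneLoop.countertermFirstOrder ζ 0 * (1 + t ^ 2) := by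
  unfold crossF
  have hconst : crossIntegrand ζ β 0 t = fun _ _ => (β / 2) * OneLoop.countertermFirstOrder ζ 0 * (1 + t ^ 2) := by
    funext θ φ
    simp [crossIntegrand, crossDet_kappa_zero]
  rw [hconst, angAvg_const]

/-- **Finding (o), kernel form: (H1) is unsatisfiable for this file's `crossF`.** For every `ζ > 0`, `β₀ > 0` and every `C`,
`¬ Stability.SmallBetaExpansion crossF ζ β₀ C` — witnessed at `κ = 0`, `t = 0`, `β = min(β₀, (c + 1/4)/(|C| + 1))` with
`c = 3(1 + (1/ζ − 1)/4) > 0` the `κ = 0` slope of `crossF_kappa_zero`. Consequently the conditional theorems `lemmaVI2_cross_of_smallBeta` and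
`lemmaVI2_cross_homothetic_of_smallBeta` of §2 are vacuous; the non-vacuous statements are file 21's (`CrossLemmaVI2.lemmaVI2_crossReg`,
`lemmaVI2_cross_homothetic`, `lemmaVI2_cross_pos`). [cite: MagnenRivasseauSeneor1993, §VI (VI.14) p.372 tl.15–17, Lemma VI.2 (VI.20b) p.374] -/
theorem not_smallBetaExpansion_crossF {ζ β₀ : ℝ} (hζ0 : 0 < ζ) (hβ₀ : 0 < β₀) (C : ℝ) :
    ¬ Stability.SmallBetaExpansion crossF ζ β₀ C := by
  intro h
  set c : ℝ := 3 * (1 + (1 / ζ - 1) / 4) with hc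
  have hc0 : 0 < c := by
    have : 0 < 1 / ζ := by positivity
    rw [hc]; nlinarith
  set β : ℝ := min β₀ ((c + 1 / 4) / (|C| + 1)) with hβdef
  have hA : 0 < |C| + 1 := by positivity
  have hβ0 : 0 < β := lt_min hβ₀ (div_pos (by linarith) hA)
  have hβle : β ≤ β₀ := min_le_left _ _
  have hβle' : β ≤ (c + 1 / 4) / (|C| + 1) := min_le_right _ _
  have h1 := h β 0 0 hβ0.le hβle le_rfl zero_le_one le_rfl zero_le_one
  rw [crossF_kappa_zero] at h1
  have hval : (β / 2) * OneLoop.countertermFirstOrder ζ 0 * (1 + (0 : ℝ) ^ 2) = c * β := by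
    unfold OneLoop.countertermFirstOrder; rw [hc]; ring
  rw [hval] at h1
  -- `C β² ≤ |C| β · β < (c + 1/4) β`, contradicting `c β ≤ −β/4 + C β²`
  have hCβ : |C| * β < c + 1 / 4 := by
    have h2 : |C| * β ≤ |C| * ((c + 1 / 4) / (|C| + 1)) := mul_le_mul_of_nonneg_left hβle' (abs_nonneg C)
    have h3 : |C| * ((c + 1 / 4) / (|C| + 1)) < c + 1 / 4 := by
      rw [mul_div_assoc', div_lt_iff₀ hA]; nlinarith [abs_nonneg C]
    exact h2.trans_lt h3
  have hCsq : C * β ^ 2 ≤ |C| * β * β := by nlinarith [le_abs_self C, sq_nonneg β]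
  nlinarith [mul_lt_mul_of_pos_right hCβ hβ0]

end CrossLargeBeta

end Literature.MathematicalPhysics.QuantumFieldTheory.MagnenRivasseauSeneor1993
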